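import Mathlib
import HarnessLib
import Summits.HubbardSuperconductivity.HubbardSuperconductivity.Theorems.KLProgrammeKLRegimeSplitFieldStrengthTimeMoment

/-!
# Route `KLProgramme` — ENGINE child gen 8 (stmt-HubbardSuperconductivity-20437 `KLRegimeEngineV17F2`), class #7 / (E3d): the FIELD STRENGTH
# from the SECTOR-PINNED temporal first moment of the SECTORISED two-leg kernel — `|z(k⃗,σ) − 1| ≤ 2·Σ_{ω ∈ A} Mᵗ_ω` with `A` the (≤ 3) sectors
# whose multipliers see `(±ω₀, k⃗)` (cell gate-hubbard-kl, seat hubbard-kl-k3c2-p3 g8; memo W3-CURRENCY.md §4(c), the time row)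

WHY.  p1b's `…SplitFieldStrengthTimeMoment` reads `z − 1` off the temporal first moment of the UNSECTORISED (trivial-multiplier) position-space
two-leg kernel.  The two-leg power-counting improvement of the curved Fermi curve that makes these moments summable over the scales (BGM 2006 §3
(3.5)–(3.6): `sup_{ω̄} J^{(2)}_{h,n,ω̄}`, one external sector FIXED) lives in SECTOR-PINNED currency; summed over the external sector it is lost again
(Thm 2.1 (2.77), `F = 0` versus `F = 1`: «the first sum `Σ_{ω₁∈O_h}` gives a contribution `O(γ^{−h/2})`»).  This file is the sector-pinned twin of
p1b's bridge, for ANY Grassmann polynomial `G`, ANY multiplier family `F : Fin N → FreqMomentum L M → ℂ` and any finite label set `A` that RESOLVES THE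
IDENTITY at the two read-out momenta, `Σ_{ω∈A} F_ω(±ω₀, k⃗) = 1` (for an angular partition of unity of the ball of scales `≤ h` — `bgmMultiplier` —
`A` = the two or three sectors around the angle of `k⃗`, at every scale whose ball contains `(±ω₀,k⃗)`):

  `‖Σ(ω₀,k⃗,σ) − Σ(−ω₀,k⃗,σ)‖ ≤ 4ω₀ · Σ_{ω∈A} Mᵗ_ω`,   `|z(k⃗,σ) − 1| ≤ 2 · Σ_{ω∈A} Mᵗ_ω`,

where `Mᵗ_ω` bounds the temporal first moment of the `F`-sectorised two-leg kernel with leg `0` PINNED AT `(x₀, ω)` — position AND sector — and leg `1`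
summed over the positions and over the labels `ω' ∈ A`: `ε_x Σ_{x : x 0 = x₀} Σ_{ω'∈A} ε_x·circDist_{2M}(t₀,t₁)·‖W_{2,((ω,σ),+),((ω',σ),−)}(x)‖ ≤ Mᵗ_ω`.
Mechanism: Fourier inversion of the sectorised kernels (`sum_sectorisedKernel_mul_conj_prod`: testing `W_{2,Ω}` against the conjugate plane waves of
`(K, K)` returns `|Λ|²·F_ω(K)F_{ω'}(K)·F₂(K)`), summed over `(ω,ω') ∈ A × A` with `Σ_A F(K) = 1`, at `K = (ω₀,k⃗)` and at `(−ω₀,k⃗)` with the SAME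
position-space kernels; the two testing phases differ by `2|sin(ω₀Δt)| ≤ 2ω₀·ε_x·circDist` (p1b's `norm_conj_phase_omega0_sub_rev`, `two_abs_sin_time_le`).
No symmetry and no evenness of `F` in the frequency is used; nothing about the model is asserted; no definitions.
References: BGM 2006 §2.1 (2.4)–(2.5), §2.7 (2.70), Thm 2.1 (2.77), §3 (3.5)–(3.6) [cite: BenfattoGiulianiMastropietro2006]; Salmhofer 1999 App. B.5.5.
-/

noncomputable section

namespace Summit.HubbardSuperconductivity.HubbardSuperconductivity.Theorems.TwoLegFourier

set_option linter.dupNamespace false -- summit = problem name (single-conjunct summit), D-0017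

open Finset Complex
open Literature.MathematicalPhysics.QuantumLattice Literature.Probability.LatticeModels GrassmannAlgebra
open Summit.HubbardSuperconductivity.HubbardSuperconductivity.Theorems.KLRegimeSplit

variable {L M N : ℕ}

/-! ## §1 Fourier inversion for the two-leg coefficient with a general multiplier family -/

/-- **Inversion for the two-leg coefficient, one sector pair**: with `W_{ωω'} = sectorisedKernel β F G 2 ((ω,σ,+),(ω',σ,−))`,
`|Λ|²·F_ω(K)·F_{ω'}(K)·F₂((K,σ,+),(K,σ,−)) = Σ_x W_{ωω'}(x)·conj(e^{-iK·x₀} e^{+iK·x₁})`. [cite: BenfattoGiulianiMastropietro2006, §2.7 (2.70)] -/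
theorem card_sq_mul_mul_kernel_two_eq_sum [NeZero L] {β : ℝ} (hβ : β ≠ 0) (F : Fin N → FreqMomentum L M → ℂ) (G : HubbardGrassmann L M)
    (K : FreqMomentum L M) (σ : Fin 2) (ω ω' : Fin N) :
    (Fintype.card (SpaceTimeIdx L M) : ℂ) ^ 2 * (F ω K * F ω' K) * kernel ℂ G 2 ![((K, σ), 0), ((K, σ), 1)] =
      ∑ x : Fin 2 → SpaceTimeIdx L M,
        sectorisedKernel L M β F G 2 (![((ω, σ), 0), ((ω', σ), 1)] : Fin 2 → SectorLeg N) x *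
          (starRingEnd ℂ) (hubbardPlaneWave L M β 0 K (x 0) * hubbardPlaneWave L M β 1 K (x 1)) := by
  have h := sum_sectorisedKernel_mul_conj_prod hβ F G 2 (![((ω, σ), 0), ((ω', σ), 1)] : Fin 2 → SectorLeg N) ![K, K]
  have hX : (fun i : Fin 2 => (((![K, K] : Fin 2 → FreqMomentum L M) i,
      ((![((ω, σ), 0), ((ω', σ), 1)] : Fin 2 → SectorLeg N) i).1.2), ((![((ω, σ), 0), ((ω', σ), 1)] : Fin 2 → SectorLeg N) i).2))
      = ![((K, σ), 0), ((K, σ), 1)] := by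
    funext i; fin_cases i <;> rfl
  rw [hX] at h
  simp only [Fin.prod_univ_two, Matrix.cons_val_zero, Matrix.cons_val_one] at h
  rw [← h]

/-- **Inversion summed over a resolving label set**: if `Σ_{ω∈A} F_ω(K) = 1` then
`|Λ|²·F₂((K,σ,+),(K,σ,−)) = Σ_{ω∈A} Σ_{ω'∈A} Σ_x W_{ωω'}(x)·conj(e^{-iK·x₀} e^{+iK·x₁})`. -/
theorem card_sq_mul_kernel_two_eq_sum_sum [NeZero L] {β : ℝ} (hβ : β ≠ 0) (F : Fin N → FreqMomentum L M → ℂ) (G : HubbardGrassmann L M)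
    (K : FreqMomentum L M) (σ : Fin 2) {A : Finset (Fin N)} (hA : ∑ ω ∈ A, F ω K = 1) :
    (Fintype.card (SpaceTimeIdx L M) : ℂ) ^ 2 * kernel ℂ G 2 ![((K, σ), 0), ((K, σ), 1)] =
      ∑ ω ∈ A, ∑ ω' ∈ A, ∑ x : Fin 2 → SpaceTimeIdx L M,
        sectorisedKernel L M β F G 2 (![((ω, σ), 0), ((ω', σ), 1)] : Fin 2 → SectorLeg N) x *
          (starRingEnd ℂ) (hubbardPlaneWave L M β 0 K (x 0) * hubbardPlaneWave L M β 1 K (x 1)) := by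
  calc (Fintype.card (SpaceTimeIdx L M) : ℂ) ^ 2 * kernel ℂ G 2 ![((K, σ), 0), ((K, σ), 1)]
      = (Fintype.card (SpaceTimeIdx L M) : ℂ) ^ 2 * ((∑ ω ∈ A, F ω K) * (∑ ω' ∈ A, F ω' K)) *
          kernel ℂ G 2 ![((K, σ), 0), ((K, σ), 1)] := by rw [hA, one_mul, mul_one]
    _ = ∑ ω ∈ A, ∑ ω' ∈ A, (Fintype.card (SpaceTimeIdx L M) : ℂ) ^ 2 * (F ω K * F ω' K) * kernel ℂ G 2 ![((K, σ), 0), ((K, σ), 1)] := by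
        rw [sum_mul_sum, mul_sum, sum_mul]
        refine sum_congr rfl fun ω _ => ?_
        rw [mul_sum, sum_mul]
    _ = _ := sum_congr rfl fun ω _ => sum_congr rfl fun ω' _ => card_sq_mul_mul_kernel_two_eq_sum hβ F G K σ ω ω'

/-! ## §2 The `±ω₀` difference of the self-energy from the sector-pinned temporal first moment -/

/-- **THE FREQUENCY DIFFERENCE OF THE SELF-ENERGY AT `±ω₀`, SECTOR-PINNED**: for `β > 0`, any `G`, any multiplier family `F`, any label set `A`
with `Σ_{ω∈A} F_ω(ω₀,k⃗) = 1 = Σ_{ω∈A} F_ω(−ω₀,k⃗)` (the family resolves the identity at the two read-out momenta on `A`), momentum `k⃗`, spin `σ`: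
if for every `ω ∈ A` the two-leg kernel sectorised with `F`, leg `0` pinned at `(x₀, ω)` and leg `1` summed over positions and over `ω' ∈ A`, has temporal
first moment `ε_x Σ_{x : x 0 = x₀} Σ_{ω'∈A} ε_x·circDist_{2M}(t₀,t₁)·‖W_{2,((ω,σ),+),((ω',σ),−)}(x)‖ ≤ Mᵗ ω` for every `x₀`, then
`‖Σ(ω₀,k⃗,σ) − Σ(−ω₀,k⃗,σ)‖ ≤ 4(π/β)·Σ_{ω∈A} Mᵗ ω`. [cite: BenfattoGiulianiMastropietro2006, §3 (3.5)–(3.6)] -/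
theorem norm_selfEnergy_omega0_sub_rev_le_of_sector_time_moment [NeZero L] [NeZero M] {β : ℝ} (hβ : 0 < β)
    (F : Fin N → FreqMomentum L M → ℂ) (G : HubbardGrassmann L M) (k : TorusSite 2 L) (σ : Fin 2) {A : Finset (Fin N)}
    (hA : ∑ ω ∈ A, F ω (omega0 M, k) = 1) (hA' : ∑ ω ∈ A, F ω ((omega0 M).rev, k) = 1) {Mt : Fin N → ℝ}
    (hMt : ∀ ω ∈ A, ∀ x₀ : SpaceTimeIdx L M, imagTimeWeight β M *
      ∑ x ∈ (univ : Finset (Fin 2 → SpaceTimeIdx L M)).filter (fun x => x 0 = x₀), ∑ ω' ∈ A,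
        imagTimeWeight β M * (circDist (2 * M) (x 0).1.val (x 1).1.val : ℝ) *
          ‖sectorisedKernel L M β F G 2 (![((ω, σ), 0), ((ω', σ), 1)] : Fin 2 → SectorLeg N) x‖ ≤ Mt ω) :
    ‖selfEnergy L M β G (omega0 M, k) σ - selfEnergy L M β G ((omega0 M).rev, k) σ‖ ≤ 4 * (Real.pi / β) * ∑ ω ∈ A, Mt ω := by
  set P : ℝ := (Fintype.card (SpaceTimeIdx L M) : ℝ) with hP
  have hPpos : 0 < P := by
    rw [hP]; exact_mod_cast (Fintype.card_pos_iff.2 ⟨(omega0 M, k)⟩ : 0 < Fintype.card (SpaceTimeIdx L M))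
  have hε : 0 ≤ imagTimeWeight β M := imagTimeWeight_nonneg hβ.le M
  have hεP : imagTimeWeight β M * P = β * (L : ℝ) ^ 2 := imagTimeWeight_mul_card β L M
  have hεpos : 0 < imagTimeWeight β M := by
    unfold imagTimeWeight
    have : (0 : ℝ) < M := by
      have hM : 0 < 2 * M := (omega0 M).pos
      exact_mod_cast Nat.pos_of_mul_pos_left hM
    positivity
  -- abbreviation for the testing phase
  set c : FreqMomentum L M → (Fin 2 → SpaceTimeIdx L M) → ℂ := fun K x =>
    (starRingEnd ℂ) (hubbardPlaneWave L M β 0 K (x 0) * hubbardPlaneWave L M β 1 K (x 1)) with hc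
  -- the difference of the two coefficients as one position-space sum over `A × A`
  have hdiff : (P : ℂ) ^ 2 * (kernel ℂ G 2 ![(((omega0 M, k), σ), 0), (((omega0 M, k), σ), 1)] -
      kernel ℂ G 2 ![((((omega0 M).rev, k), σ), 0), ((((omega0 M).rev, k), σ), 1)]) =
      ∑ ω ∈ A, ∑ ω' ∈ A, ∑ x : Fin 2 → SpaceTimeIdx L M, sectorisedKernel L M β F G 2 (![((ω, σ), 0), ((ω', σ), 1)] : Fin 2 → SectorLeg N) x * (c (omega0 M, k) x - c ((omega0 M).rev, k) x) := by
    have h1 := card_sq_mul_kernel_two_eq_sum_sum hβ.ne' F G (omega0 M, k) σ hA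
    have h2 := card_sq_mul_kernel_two_eq_sum_sum hβ.ne' F G ((omega0 M).rev, k) σ hA'
    have hPc : ((Fintype.card (SpaceTimeIdx L M) : ℕ) : ℂ) = (P : ℂ) := by rw [hP]; norm_cast
    rw [hPc] at h1 h2
    rw [mul_sub, h1, h2, ← sum_sub_distrib]
    refine sum_congr rfl fun ω _ => ?_
    rw [← sum_sub_distrib]
    refine sum_congr rfl fun ω' _ => ?_
    rw [← sum_sub_distrib]
    exact sum_congr rfl fun x _ => by rw [hc]; ring
  -- norm of the position-space sum: `≤ (2π/β) Σ_{ω,ω'∈A} Σ_x ε circDist ‖W x‖`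
  have hsum : ‖∑ ω ∈ A, ∑ ω' ∈ A, ∑ x : Fin 2 → SpaceTimeIdx L M, sectorisedKernel L M β F G 2 (![((ω, σ), 0), ((ω', σ), 1)] : Fin 2 → SectorLeg N) x * (c (omega0 M, k) x - c ((omega0 M).rev, k) x)‖ ≤
      2 * (Real.pi / β) * ∑ ω ∈ A, ∑ ω' ∈ A, ∑ x : Fin 2 → SpaceTimeIdx L M,
        imagTimeWeight β M * (circDist (2 * M) (x 0).1.val (x 1).1.val : ℝ) * ‖sectorisedKernel L M β F G 2 (![((ω, σ), 0), ((ω', σ), 1)] : Fin 2 → SectorLeg N) x‖ := by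
    calc ‖∑ ω ∈ A, ∑ ω' ∈ A, ∑ x : Fin 2 → SpaceTimeIdx L M, sectorisedKernel L M β F G 2 (![((ω, σ), 0), ((ω', σ), 1)] : Fin 2 → SectorLeg N) x * (c (omega0 M, k) x - c ((omega0 M).rev, k) x)‖
        ≤ ∑ ω ∈ A, ∑ ω' ∈ A, ∑ x : Fin 2 → SpaceTimeIdx L M, 2 * (Real.pi / β) *
            (imagTimeWeight β M * (circDist (2 * M) (x 0).1.val (x 1).1.val : ℝ) * ‖sectorisedKernel L M β F G 2 (![((ω, σ), 0), ((ω', σ), 1)] : Fin 2 → SectorLeg N) x‖) := by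
          refine (norm_sum_le _ _).trans (sum_le_sum fun ω _ => (norm_sum_le _ _).trans (sum_le_sum fun ω' _ =>
            (norm_sum_le _ _).trans (sum_le_sum fun x _ => ?_)))
          rw [norm_mul, hc]
          simp only []
          rw [norm_conj_phase_omega0_sub_rev]
          have h := two_abs_sin_time_le hβ (x 0).1 (x 1).1
          have hW0 : 0 ≤ ‖sectorisedKernel L M β F G 2 (![((ω, σ), 0), ((ω', σ), 1)] : Fin 2 → SectorLeg N) x‖ :=
            norm_nonneg _
          nlinarith
      _ = 2 * (Real.pi / β) * ∑ ω ∈ A, ∑ ω' ∈ A, ∑ x : Fin 2 → SpaceTimeIdx L M,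
            imagTimeWeight β M * (circDist (2 * M) (x 0).1.val (x 1).1.val : ℝ) * ‖sectorisedKernel L M β F G 2 (![((ω, σ), 0), ((ω', σ), 1)] : Fin 2 → SectorLeg N) x‖ := by
          simp only [mul_sum]
  -- slice by the position of leg 0, exchange `ω'` and `x`, and use the hypothesis
  have hslice : ∑ ω ∈ A, ∑ ω' ∈ A, ∑ x : Fin 2 → SpaceTimeIdx L M,
        imagTimeWeight β M * (circDist (2 * M) (x 0).1.val (x 1).1.val : ℝ) * ‖sectorisedKernel L M β F G 2 (![((ω, σ), 0), ((ω', σ), 1)] : Fin 2 → SectorLeg N) x‖ ≤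
      P * (∑ ω ∈ A, Mt ω) / imagTimeWeight β M := by
    rw [le_div_iff₀ hεpos, sum_mul, mul_sum]
    refine sum_le_sum fun ω hω => ?_
    rw [sum_comm, ← sum_fiberwise_of_maps_to (s := univ) (t := (univ : Finset (SpaceTimeIdx L M))) (g := fun x => x 0)
      (fun _ _ => mem_univ _), sum_mul]
    have hP' : P * Mt ω = ∑ _x₀ : SpaceTimeIdx L M, Mt ω := by rw [sum_const, card_univ, nsmul_eq_mul, hP]
    rw [hP']
    refine sum_le_sum fun x₀ _ => ?_
    rw [mul_comm]
    exact hMt ω hω x₀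
  -- assemble: `Σ₊ − Σ₋ = 2βL²·(F₊ − F₋)`, `βL² = εP`
  rw [selfEnergy_eq_vertexFn, selfEnergy_eq_vertexFn, ← mul_sub, norm_mul, Complex.norm_real, Real.norm_eq_abs,
    abs_of_nonneg (by positivity)]
  have hker : ‖kernel ℂ G 2 ![(((omega0 M, k), σ), 0), (((omega0 M, k), σ), 1)] -
      kernel ℂ G 2 ![((((omega0 M).rev, k), σ), 0), ((((omega0 M).rev, k), σ), 1)]‖ ≤
      2 * (Real.pi / β) * (P * (∑ ω ∈ A, Mt ω) / imagTimeWeight β M) / P ^ 2 := by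
    rw [le_div_iff₀ (by positivity), mul_comm]
    have h := congrArg (fun z : ℂ => ‖z‖) hdiff
    simp only [norm_mul, norm_pow, Complex.norm_real, Real.norm_eq_abs, abs_of_pos hPpos] at h
    rw [h]
    exact hsum.trans (mul_le_mul_of_nonneg_left hslice (by positivity))
  calc 2 * (β * (L : ℝ) ^ 2) * ‖kernel ℂ G 2 ![(((omega0 M, k), σ), 0), (((omega0 M, k), σ), 1)] -
        kernel ℂ G 2 ![((((omega0 M).rev, k), σ), 0), ((((omega0 M).rev, k), σ), 1)]‖
      ≤ 2 * (β * (L : ℝ) ^ 2) * (2 * (Real.pi / β) * (P * (∑ ω ∈ A, Mt ω) / imagTimeWeight β M) / P ^ 2) :=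
        mul_le_mul_of_nonneg_left hker (by positivity)
    _ = 4 * (Real.pi / β) * ∑ ω ∈ A, Mt ω := by
        rw [← hεP]
        field_simp
        ring

/-! ## §3 The field strength, sector-pinned -/

/-- **(E3d) FROM THE SECTOR-PINNED TEMPORAL FIRST MOMENT, per spin**: under the hypotheses of `norm_selfEnergy_omega0_sub_rev_le_of_sector_time_moment`,
`|z(k⃗,σ) − 1| ≤ 2·Σ_{ω∈A} Mᵗ ω` (`|Im a − Im b| ≤ ‖a − b‖`). No symmetry of `G`, no evenness of `F` in the frequency is used.
[cite: BenfattoGiulianiMastropietro2006, §3 (3.5)–(3.6)] -/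
theorem abs_fieldStrengthSpin_sub_one_le_of_sector_time_moment [NeZero L] [NeZero M] {β : ℝ} (hβ : 0 < β)
    (F : Fin N → FreqMomentum L M → ℂ) (G : HubbardGrassmann L M) (k : TorusSite 2 L) (σ : Fin 2) {A : Finset (Fin N)}
    (hA : ∑ ω ∈ A, F ω (omega0 M, k) = 1) (hA' : ∑ ω ∈ A, F ω ((omega0 M).rev, k) = 1) {Mt : Fin N → ℝ}
    (hMt : ∀ ω ∈ A, ∀ x₀ : SpaceTimeIdx L M, imagTimeWeight β M *
      ∑ x ∈ (univ : Finset (Fin 2 → SpaceTimeIdx L M)).filter (fun x => x 0 = x₀), ∑ ω' ∈ A,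
        imagTimeWeight β M * (circDist (2 * M) (x 0).1.val (x 1).1.val : ℝ) *
          ‖sectorisedKernel L M β F G 2 (![((ω, σ), 0), ((ω', σ), 1)] : Fin 2 → SectorLeg N) x‖ ≤ Mt ω) :
    |fieldStrengthSpin L M β G k σ - 1| ≤ 2 * ∑ ω ∈ A, Mt ω := by
  have h := norm_selfEnergy_omega0_sub_rev_le_of_sector_time_moment hβ F G k σ hA hA' hMt
  have hω : 0 < 2 * (Real.pi / β) := by positivity
  rw [fieldStrengthSpin, sub_sub_cancel_left, abs_neg, abs_div, abs_of_pos hω, div_le_iff₀ hω]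
  have him : |(selfEnergy L M β G (omega0 M, k) σ).im - (selfEnergy L M β G ((omega0 M).rev, k) σ).im| ≤
      ‖selfEnergy L M β G (omega0 M, k) σ - selfEnergy L M β G ((omega0 M).rev, k) σ‖ := by
    rw [← Complex.sub_im]
    exact Complex.abs_im_le_norm _
  calc _ ≤ ‖selfEnergy L M β G (omega0 M, k) σ - selfEnergy L M β G ((omega0 M).rev, k) σ‖ := him
    _ ≤ 4 * (Real.pi / β) * ∑ ω ∈ A, Mt ω := h
    _ = 2 * (∑ ω ∈ A, Mt ω) * (2 * (Real.pi / β)) := by ring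

/-- **(E3d) for the spin-averaged field strength, sector-pinned**: with the sector-pinned time-moment bound for both spin strings,
`|z(k⃗) − 1| ≤ 2·Σ_{ω∈A} Mᵗ ω`. -/
theorem abs_fieldStrength_sub_one_le_of_sector_time_moment [NeZero L] [NeZero M] {β : ℝ} (hβ : 0 < β)
    (F : Fin N → FreqMomentum L M → ℂ) (G : HubbardGrassmann L M) (k : TorusSite 2 L) {A : Finset (Fin N)}
    (hA : ∑ ω ∈ A, F ω (omega0 M, k) = 1) (hA' : ∑ ω ∈ A, F ω ((omega0 M).rev, k) = 1) {Mt : Fin N → ℝ}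
    (hMt : ∀ (σ : Fin 2), ∀ ω ∈ A, ∀ x₀ : SpaceTimeIdx L M, imagTimeWeight β M *
      ∑ x ∈ (univ : Finset (Fin 2 → SpaceTimeIdx L M)).filter (fun x => x 0 = x₀), ∑ ω' ∈ A,
        imagTimeWeight β M * (circDist (2 * M) (x 0).1.val (x 1).1.val : ℝ) *
          ‖sectorisedKernel L M β F G 2 (![((ω, σ), 0), ((ω', σ), 1)] : Fin 2 → SectorLeg N) x‖ ≤ Mt ω) :
    |fieldStrength L M β G k - 1| ≤ 2 * ∑ ω ∈ A, Mt ω := by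
  have h0 := abs_fieldStrengthSpin_sub_one_le_of_sector_time_moment hβ F G k 0 hA hA' (hMt 0)
  have h1 := abs_fieldStrengthSpin_sub_one_le_of_sector_time_moment hβ F G k 1 hA hA' (hMt 1)
  rw [fieldStrength]
  have : (fieldStrengthSpin L M β G k 0 + fieldStrengthSpin L M β G k 1) / 2 - 1 =
      ((fieldStrengthSpin L M β G k 0 - 1) + (fieldStrengthSpin L M β G k 1 - 1)) / 2 := by ring
  rw [this, abs_div, abs_two]
  have htri := abs_add_le (fieldStrengthSpin L M β G k 0 - 1) (fieldStrengthSpin L M β G k 1 - 1)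
  linarith

/-- **SINGLE-PLATEAU FORM**: if ONE multiplier `F_ω` equals `1` at both `(ω₀,k⃗)` and `(−ω₀,k⃗)` (the read-out momentum lies in the plateau of
sector `ω`), then `|z(k⃗) − 1| ≤ 2·Mᵗ` with `Mᵗ` the temporal first moment of the single `(ω,ω)`-sectorised two-leg kernel, leg `0` pinned at
`(x₀, ω)`, leg `1` at sector `ω` summed over positions — one sector, no sum over the family. -/
theorem abs_fieldStrength_sub_one_le_of_plateau_time_moment [NeZero L] [NeZero M] {β : ℝ} (hβ : 0 < β)
    (F : Fin N → FreqMomentum L M → ℂ) (G : HubbardGrassmann L M) (k : TorusSite 2 L) {ω : Fin N}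
    (hω : F ω (omega0 M, k) = 1) (hω' : F ω ((omega0 M).rev, k) = 1) {Mt : ℝ}
    (hMt : ∀ (σ : Fin 2) (x₀ : SpaceTimeIdx L M), imagTimeWeight β M *
      ∑ x ∈ (univ : Finset (Fin 2 → SpaceTimeIdx L M)).filter (fun x => x 0 = x₀),
        imagTimeWeight β M * (circDist (2 * M) (x 0).1.val (x 1).1.val : ℝ) *
          ‖sectorisedKernel L M β F G 2 (![((ω, σ), 0), ((ω, σ), 1)] : Fin 2 → SectorLeg N) x‖ ≤ Mt) :
    |fieldStrength L M β G k - 1| ≤ 2 * Mt := by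
  have h := abs_fieldStrength_sub_one_le_of_sector_time_moment hβ F G k (A := {ω}) (by simpa using hω) (by simpa using hω')
    (Mt := fun _ => Mt) (fun σ ω₁ hω₁ x₀ => by
      rw [mem_singleton] at hω₁
      subst hω₁
      simpa only [sum_singleton] using hMt σ x₀)
  simpa only [sum_singleton] using h

end Summit.HubbardSuperconductivity.HubbardSuperconductivity.Theorems.TwoLegFourier

end
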